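import Summits.QuantumFields.BalabanUV.Beta.NVertexLamWeightLadder
import Summits.QuantumFields.BalabanUV.Beta.CoclosedCovectorCompositeRows
import Summits.QuantumFields.BalabanUV.Beta.StraightColumnK1Row
import Summits.QuantumFields.BalabanUV.Beta.GAN24.TaylorLamBracket

/-!
# `BalabanUV.Beta.NVertexLamStraightPullback` — row D1 ∕ (C1) OWNER an2 (gen 63), PART 21: **THE TRANSPORTED MULTIPLIER RESPONSES OF THE N-VERTEX's Λ SECTOR ARE
# STRAIGHT PULLBACKS — `Λ′_N μ y` is a bounded COARSE CO-CLOSED covector at every depth, hence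
# `λ′ᴿ (κ,s) = ((Lc⁴)⁻¹)^m · Σ_ν Σ'_w Λ′_N (ν,w) · straightCount (Lc^m) ν w (κ,s)` for every transport depth `m`, and the (K1)-row's right side one brick
# further down is the depth-`(m+1)` pullback** (PART 20 `CoclosedCovectorCompositeRows` AT THE RECORD; brick-, root- and corrector-free closed forms)

HONEST FRAMING (cell charter, verbatim): «discharging `BetaPertH` makes Bałaban's UV stability UNCONDITIONAL — a real constructive-QFT result; it
is NOT the continuum limit and NOT the Clay problem.»  THIS MODULE DISCHARGES NOTHING of `BetaPertH` ∕ row D1: [folklore] bookkeeping BY NAME over the row's OWN objects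
— the contracted multiplier response `Λ′_N μ y ν w = Σ_{κ′} Σ'_u (AN R j) u (L•y) (inl κ′) (inr μ) · lamCoeffOf (KInv L) L ν w κ′ u` (PART 14, written out, no `def`),
its transports `λ′ᴿ` (PARTs 15–19), an2 g60's `StraightColumnK1Row.codiff₁_lamCovector` (the `Λ′`-covector of ANY bounded summable fine field is coarse co-closed),
`NVertexSectors.decays_AN`, the GAN24 lane's `TaylorLamBracket.exists_abs_lamCoeffOf_KInv_le` (uniform bound of the straight chart's coefficients), PART 18
`NVertexLamWeightLadder.lamR_succ`, PART 20.
0 `def`, 0 `def … : Prop`, 0 sorry, nothing cited; no table VALUE, no estimate.  NOT (C1), NOT K1, NOT D1, NEVER «G-an2-4 closed», NOT BetaPertH, NOT continuum, NOT Clay.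

WHY (row D1 OWNER, gen 63; journal [AN2-G63-ONLINE] J-NOTE-1 (a)∕(d)).  The (J-Λ) junction of the END wrapper's `hHN₁` reads, storey by storey, the weights
`λ′ᴿ_k (κ,s) = Σ_ν Σ'_w Λ′_N (ν,w) · compLinKer ℓ Lc (j−k) (κ,s) (ν,w)` (PARTs 15–17; an2's storey `k` = the wrapper's level `n+1−k`) and, at the finest level,
the (K1) row `c·Ê″·h = w·Σ_slot λ_{n+1}(slot)·symLinKerAt ρ Lc slot (·)` whose weight for the composite column is the FULLY transported `λ′ᴿ_0`.  PART 20 says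
these transports are straight pullbacks AS SOON AS `Λ′_N μ y` is bounded and co-closed.  THIS FILE supplies the two letters at the record and reads off the
closed forms: §1 `Λ′_N μ y ν w = Σ'_u Σ_{κ′} lamCoeffOf … ν w κ′ u · colN κ′ u` (one finite∕`tsum` exchange), **`codiff₁_LamN`** (g60 `codiff₁_lamCovector` at the
column `colN κ′ u := (AN R j) u (L•y) (inl κ′) (inr μ)`, bounded and summable by `decays_AN`), **`exists_abs_LamN_le`** (`|Λ′_N| ≤ 4·C_Λ·C_A·Σ'_v e^{−δ|v|₁}`);
§2 **`lamR_eq_straightCount`** (`λ′ᴿ` at transport depth `m` `= ((Lc⁴)⁻¹)^m·⟪Λ′_N, straightCount (Lc^m) · · (κ,s)⟫`, PART 20 `tsum_sum_mul_compLinKer_symLinKerAt_of_bounded`),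
**`tsum_lamR_mul_symLinKerAt_eq_straightCount`** (the (K1)-row shape: `Σ_{κ₁} Σ'_{s₁} λ′ᴿ_m (κ₁,s₁)·symLinKerAt ρ Lc κ₁ s₁ (κ,s) = ((Lc⁴)⁻¹)^{m+1}·⟪Λ′_N, straightCount (Lc^{m+1}) · · (κ,s)⟫`
— PART 18 `lamR_succ` read backwards, then §2), `lamR_full_eq_straightCount_pow` (depth `j+1`: the N-vertex's full linearisation `N = Lc^{j+1}` — the one-shot blocking).
READING (zero weight): with the straight reading `Λ′_N = −Φ^ℋ_N·(𝒬_N colN)` (g60 `lamCoeffOf_KInv` + (EL)) the (K1) row for the composite column is thereby ONE lattice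
sentence about `E″·colN` against `𝒬_Nᵀ Φ^ℋ_N 𝒬_N colN`; nothing of it is claimed here.  NOT HERE: the periodisation (PART 16∕17 currency), (K1), `hlink`, (J-Λ).

WHAT (all [folklore]; `L = Lc^(j+1)`, `R : Roots Lc` any, `j` any):
* §1 `abs_AN_col_le`, `summable_AN_col`, `LamN_eq_tsum_sum` (the exchange), **`codiff₁_LamN`**, `abs_LamN_le` ∕ **`exists_abs_LamN_le`**.
* §2 **`lamR_eq_straightCount`**, **`tsum_lamR_mul_symLinKerAt_eq_straightCount`**, `lamR_full_eq_straightCount_pow`.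

HONEST DEPENDENCY (verbatim): «continuum YM on T⁴ ⇐ BetaPertH ∧ nine spine estimates (0/9 proved); BetaPertH ⇐ (D1) ∧ (D4) ∧ CAP+tail;
G-an2-4 gates asym, D1 and NE2/3/4.»  ABSOLUTE RULE (cell, verbatim): «No internally-minted statement may enter as a cited fact. Every
hypothesis is either kernel-proved in this package or a verbatim quotation of a PUBLISHED theorem with page reference.»
Unit `b2b-balaban-beta-an2` gen 63 (row-D1 owner), 2026-08-27; `bears_on: R4-O/T1|T1a` (a (C1)-side identity behind the displayed rows (K1) ∕ `hlink`; moves no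
node counter).  No existing file touched.
-/

noncomputable section

open scoped BigOperators

namespace Summit.QuantumFields.BalabanUV.Beta.NVertexLamStraightPullback

open Finset
open Literature.MathematicalPhysics.QuantumFieldTheory
open Literature.MathematicalPhysics.QuantumFieldTheory.Balaban1983to89
open Literature.MathematicalPhysics.QuantumFieldTheory.Balaban1983to89.Beta
open B12Sec2to5 (l1 l1_nonneg summable_exp_neg_l1)
open AffineAveraging (Form1 Site box toSite codiff₁)
open AveragingHessianKernels (Bond straightCount)
open ExpKernelCalculus (MKer Decays)
open OneStepResolventKernel (Fib KInv)
open BalabanStepJets (lamCoeffOf)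
open KKTFluctuationEnergy (lip1 summable_of_exp_bound summable_mul_of_bdd abs_le_of_exp_bound)
open Summit.QuantumFields.BalabanUV.Beta.AxialDressingRooted (one_le_of_neZero)
open Summit.QuantumFields.BalabanUV.Beta.SymAveragingHessianCounts (symLinKerAt)
open Summit.QuantumFields.BalabanUV.Beta.CompositeVertexKernelRec (compLinKer)
open Summit.QuantumFields.BalabanUV.Beta.CompositeOneShotJetData (Roots AN)
open Summit.QuantumFields.BalabanUV.Beta.NVertexSectors (decays_AN)
open Summit.QuantumFields.BalabanUV.Beta.NVertexLamWeightLadder (lamR_succ)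
open Summit.QuantumFields.BalabanUV.Beta.StraightColumnK1Row (codiff₁_lamCovector)
open Summit.QuantumFields.BalabanUV.Beta.GAN24.TaylorLamBracket (exists_abs_lamCoeffOf_KInv_le)
open Summit.QuantumFields.BalabanUV.Beta.CoclosedCovectorCompositeRows (tsum_sum_mul_compLinKer_symLinKerAt_of_bounded abs_lip1_straightCount_le
  codiff₁_lip1_straightCount)

variable {Lc : ℕ} [NeZero Lc] (R : Roots Lc) (j : ℕ)

/-! ## §1 `Λ′_N μ y` is a bounded coarse co-closed covector -/

section Letters

/-- [folklore] the one-shot N-chart's column sourced at `(μ, L•y)` decays from its source: `|AN R j u (L•y) (inl κ′) (inr μ)| ≤ C · e^{−δ|u − L•y|₁}` for the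
constants of `NVertexSectors.decays_AN`. -/
theorem abs_AN_col_le {C δ : ℝ} (hK : Decays (AN R j) C δ) (μ κ' : Fin (3 + 1)) (y u : Site (3 + 1)) :
    |AN R j u (((Lc ^ (j + 1) : ℕ) : ℤ) • y) (Sum.inl κ') (Sum.inr μ)| ≤ C * Real.exp (-δ * l1 (u - ((Lc ^ (j + 1) : ℕ) : ℤ) • y)) :=
  hK _ _ _ _

/-- [folklore] … hence the column is summable in its fine site. -/
theorem summable_AN_col (μ κ' : Fin (3 + 1)) (y : Site (3 + 1)) :
    Summable fun u : Site (3 + 1) => AN R j u (((Lc ^ (j + 1) : ℕ) : ℤ) • y) (Sum.inl κ') (Sum.inr μ) := by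
  obtain ⟨δ, C, hδ, -, hK⟩ := decays_AN R j
  exact summable_of_exp_bound hδ _ (abs_AN_col_le R j hK μ κ' y)

/-- [folklore] **`LamN_eq_tsum_sum` — THE EXCHANGE**: `Λ′_N μ y ν w = Σ'_u Σ_{κ′} lamCoeffOf (KInv L) L ν w κ′ u · (AN R j) u (L•y) (inl κ′) (inr μ)` (finite `κ′`-sum out of a
convergent `u`-sum: the column is summable, the coefficient bounded) — g60's `Λ′`-covector of the fine field `colN κ′ u := (AN R j) u (L•y) (inl κ′) (inr μ)`. -/
theorem LamN_eq_tsum_sum (μ ν : Fin (3 + 1)) (y w : Site (3 + 1)) :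
    (∑ κ' : Fin (3 + 1), ∑' u : Site (3 + 1),
        AN R j u (((Lc ^ (j + 1) : ℕ) : ℤ) • y) (Sum.inl κ') (Sum.inr μ) * lamCoeffOf (KInv (N := Lc ^ (j + 1)) (d := 3)) (Lc ^ (j + 1)) ν w κ' u)
      = ∑' u : Site (3 + 1), ∑ κ' : Fin (3 + 1),
          lamCoeffOf (KInv (N := Lc ^ (j + 1)) (d := 3)) (Lc ^ (j + 1)) ν w κ' u * AN R j u (((Lc ^ (j + 1) : ℕ) : ℤ) • y) (Sum.inl κ') (Sum.inr μ) := by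
  obtain ⟨CΛ, -, hΛ⟩ := exists_abs_lamCoeffOf_KInv_le (N := Lc ^ (j + 1)) (d := 3)
  rw [Summable.tsum_finsetSum fun κ' _ => summable_mul_of_bdd (fun u => hΛ ν w κ' u) (summable_AN_col R j μ κ' y)]
  exact Finset.sum_congr rfl fun κ' _ => tsum_congr fun u => mul_comm _ _

/-- [folklore] **`codiff₁_LamN` — THE CONTRACTED MULTIPLIER RESPONSE IS COARSE CO-CLOSED AT EVERY DEPTH**: for every source label `(μ, y)`,
`codiff₁ ((ν, w) ↦ Λ′_N μ y ν w) = 0` (an2 g60 `StraightColumnK1Row.codiff₁_lamCovector` at the bounded summable fine field `colN`). -/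
theorem codiff₁_LamN (μ : Fin (3 + 1)) (y : Site (3 + 1)) :
    codiff₁ (fun ν w => ∑ κ' : Fin (3 + 1), ∑' u : Site (3 + 1),
        AN R j u (((Lc ^ (j + 1) : ℕ) : ℤ) • y) (Sum.inl κ') (Sum.inr μ) * lamCoeffOf (KInv (N := Lc ^ (j + 1)) (d := 3)) (Lc ^ (j + 1)) ν w κ' u) = 0 := by
  obtain ⟨δ, C, hδ, hC, hK⟩ := decays_AN R j
  have h := codiff₁_lamCovector (N := Lc ^ (j + 1)) (d := 3) (h := fun κ' u => AN R j u (((Lc ^ (j + 1) : ℕ) : ℤ) • y) (Sum.inl κ') (Sum.inr μ))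
    (M := C) (fun κ' u => abs_le_of_exp_bound hδ hC _ (abs_AN_col_le R j hK μ κ' y) u) (fun κ' => summable_AN_col R j μ κ' y)
  rw [show (fun ν w => ∑ κ' : Fin (3 + 1), ∑' u : Site (3 + 1),
        AN R j u (((Lc ^ (j + 1) : ℕ) : ℤ) • y) (Sum.inl κ') (Sum.inr μ) * lamCoeffOf (KInv (N := Lc ^ (j + 1)) (d := 3)) (Lc ^ (j + 1)) ν w κ' u)
      = fun ν w => ∑' u : Site (3 + 1), ∑ κ' : Fin (3 + 1),
          lamCoeffOf (KInv (N := Lc ^ (j + 1)) (d := 3)) (Lc ^ (j + 1)) ν w κ' u * AN R j u (((Lc ^ (j + 1) : ℕ) : ℤ) • y) (Sum.inl κ') (Sum.inr μ) from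
    funext fun ν => funext fun w => LamN_eq_tsum_sum R j μ ν y w]
  exact h

/-- [folklore] **`abs_LamN_le` — THE CONTRACTED MULTIPLIER RESPONSE IS BOUNDED**, uniformly in the source label and the slot: with the column's decay constants `C, δ`
(`decays_AN`) and a bound `CΛ` of the coefficients, `|Λ′_N μ y ν w| ≤ 4·CΛ·(C·Σ'_v e^{−δ|v|₁})`. -/
theorem abs_LamN_le {C δ CΛ : ℝ} (hK : Decays (AN R j) C δ) (hδ : 0 < δ)
    (hΛ : ∀ (ν : Fin (3 + 1)) (w : Site (3 + 1)) (κ' : Fin (3 + 1)) (u : Site (3 + 1)),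
      |lamCoeffOf (KInv (N := Lc ^ (j + 1)) (d := 3)) (Lc ^ (j + 1)) ν w κ' u| ≤ CΛ)
    (μ ν : Fin (3 + 1)) (y w : Site (3 + 1)) :
    |∑ κ' : Fin (3 + 1), ∑' u : Site (3 + 1),
        AN R j u (((Lc ^ (j + 1) : ℕ) : ℤ) • y) (Sum.inl κ') (Sum.inr μ) * lamCoeffOf (KInv (N := Lc ^ (j + 1)) (d := 3)) (Lc ^ (j + 1)) ν w κ' u|
      ≤ ((3 + 1 : ℕ) : ℝ) * (CΛ * (C * ∑' v : Site (3 + 1), Real.exp (-δ * l1 v))) := by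
  have hcol : ∀ κ' : Fin (3 + 1), Summable fun u : Site (3 + 1) => AN R j u (((Lc ^ (j + 1) : ℕ) : ℤ) • y) (Sum.inl κ') (Sum.inr μ) :=
    fun κ' => summable_of_exp_bound hδ _ (abs_AN_col_le R j hK μ κ' y)
  have hZ : ∀ κ' : Fin (3 + 1), ∑' u : Site (3 + 1), |AN R j u (((Lc ^ (j + 1) : ℕ) : ℤ) • y) (Sum.inl κ') (Sum.inr μ)|
      ≤ C * ∑' v : Site (3 + 1), Real.exp (-δ * l1 v) := by
    intro κ'
    have hs : Summable fun u : Site (3 + 1) => Real.exp (-δ * l1 (u - ((Lc ^ (j + 1) : ℕ) : ℤ) • y)) :=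
      KKTFluctuationEnergy.summable_shift_sub (summable_exp_neg_l1 hδ (3 + 1)) _
    refine (Summable.tsum_le_tsum (abs_AN_col_le R j hK μ κ' y) (hcol κ').abs (hs.mul_left C)).trans ?_
    rw [tsum_mul_left, KKTFluctuationEnergy.tsum_shift_sub (fun v : Site (3 + 1) => Real.exp (-δ * l1 v))]
  have hterm : ∀ κ' : Fin (3 + 1), |∑' u : Site (3 + 1),
      AN R j u (((Lc ^ (j + 1) : ℕ) : ℤ) • y) (Sum.inl κ') (Sum.inr μ) * lamCoeffOf (KInv (N := Lc ^ (j + 1)) (d := 3)) (Lc ^ (j + 1)) ν w κ' u|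
        ≤ CΛ * (C * ∑' v : Site (3 + 1), Real.exp (-δ * l1 v)) := by
    intro κ'
    have hCΛ : 0 ≤ CΛ := (abs_nonneg _).trans (hΛ ν w κ' 0)
    have h1 := BalabanCompositeJets.abs_tsum_mul_le (H := fun u => lamCoeffOf (KInv (N := Lc ^ (j + 1)) (d := 3)) (Lc ^ (j + 1)) ν w κ' u)
      (fun u => hΛ ν w κ' u) (hcol κ')
    rw [show (fun u : Site (3 + 1) => AN R j u (((Lc ^ (j + 1) : ℕ) : ℤ) • y) (Sum.inl κ') (Sum.inr μ)
        * lamCoeffOf (KInv (N := Lc ^ (j + 1)) (d := 3)) (Lc ^ (j + 1)) ν w κ' u)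
      = fun u => lamCoeffOf (KInv (N := Lc ^ (j + 1)) (d := 3)) (Lc ^ (j + 1)) ν w κ' u * AN R j u (((Lc ^ (j + 1) : ℕ) : ℤ) • y) (Sum.inl κ') (Sum.inr μ)
      from funext fun u => mul_comm _ _]
    exact h1.trans (mul_le_mul_of_nonneg_left (hZ κ') hCΛ)
  refine (abs_sum_le_sum_abs _ _).trans ((sum_le_sum fun κ' _ => hterm κ').trans ?_)
  rw [sum_const, card_univ, Fintype.card_fin, nsmul_eq_mul]

/-- [folklore] **`exists_abs_LamN_le`** — a bound of `Λ′_N` uniform in the source label `(μ, y)` and the slot `(ν, w)`. -/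
theorem exists_abs_LamN_le : ∃ M : ℝ, ∀ (μ ν : Fin (3 + 1)) (y w : Site (3 + 1)),
    |∑ κ' : Fin (3 + 1), ∑' u : Site (3 + 1),
        AN R j u (((Lc ^ (j + 1) : ℕ) : ℤ) • y) (Sum.inl κ') (Sum.inr μ) * lamCoeffOf (KInv (N := Lc ^ (j + 1)) (d := 3)) (Lc ^ (j + 1)) ν w κ' u| ≤ M := by
  obtain ⟨δ, C, hδ, -, hK⟩ := decays_AN R j
  obtain ⟨CΛ, -, hΛ⟩ := exists_abs_lamCoeffOf_KInv_le (N := Lc ^ (j + 1)) (d := 3)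
  exact ⟨_, fun μ ν y w => abs_LamN_le R j hK hδ hΛ μ ν y w⟩

end Letters

/-! ## §2 The transported responses in closed form -/

section Closed

/-- [folklore] **`lamR_eq_straightCount` — THE TRANSPORTED MULTIPLIER RESPONSE IS A STRAIGHT PULLBACK**: at the record's constant brick list `ℓ _ := symLinKerAt (toSite R.r) Lc`,
for every transport depth `m` and lower slot `(κ, s)`,
`Σ_ν Σ'_w Λ′_N μ y ν w · compLinKer ℓ Lc m (κ,s) (ν,w) = ((Lc⁴)⁻¹)^m · Σ_ν Σ'_w Λ′_N μ y ν w · straightCount (Lc^m) ν w (κ,s)` — no brick, no root, no corrector left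
(PART 20 `tsum_sum_mul_compLinKer_symLinKerAt_of_bounded` at `codiff₁_LamN` ∕ `exists_abs_LamN_le`). -/
theorem lamR_eq_straightCount (m : ℕ) (μ κ : Fin (3 + 1)) (y s : Site (3 + 1)) :
    (∑ ν : Fin (3 + 1), ∑' w : Site (3 + 1),
        (∑ κ' : Fin (3 + 1), ∑' u : Site (3 + 1),
            AN R j u (((Lc ^ (j + 1) : ℕ) : ℤ) • y) (Sum.inl κ') (Sum.inr μ) * lamCoeffOf (KInv (N := Lc ^ (j + 1)) (d := 3)) (Lc ^ (j + 1)) ν w κ' u)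
          * compLinKer (fun _ => symLinKerAt (toSite R.r) Lc) Lc m (κ, s) (ν, w))
      = (((Lc : ℝ) ^ (3 + 1))⁻¹) ^ m * ∑ ν : Fin (3 + 1), ∑' w : Site (3 + 1),
          (∑ κ' : Fin (3 + 1), ∑' u : Site (3 + 1),
              AN R j u (((Lc ^ (j + 1) : ℕ) : ℤ) • y) (Sum.inl κ') (Sum.inr μ) * lamCoeffOf (KInv (N := Lc ^ (j + 1)) (d := 3)) (Lc ^ (j + 1)) ν w κ' u)
            * (straightCount (Lc ^ m) ν w (κ, s) : ℝ) := by
  obtain ⟨M, hM⟩ := exists_abs_LamN_le R j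
  exact tsum_sum_mul_compLinKer_symLinKerAt_of_bounded (d := 3) (fun ν w => hM μ ν y w) (codiff₁_LamN R j μ y)
    (Nat.pos_of_ne_zero (NeZero.ne Lc)) (fun _ => R.hr) m (κ, s)

/-- [folklore] **`tsum_lamR_mul_symLinKerAt_eq_straightCount` — THE (K1)-ROW SHAPE**: the depth-`m` transported response contracted with ONE MORE (0.4)-sym brick on a lower
bond `(κ, s)` — the shape `Σ_{μ′} Σ'_{y′} λ(μ′,y′)·symLinKerAt ρ Lc μ′ y′ u` of the END wrapper's (K1) ∕ `hlink` rows — is the depth-`(m+1)` straight pullback: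
`Σ_{κ₁} Σ'_{s₁} λ′ᴿ_m (κ₁,s₁) · symLinKerAt (toSite R.r) Lc κ₁ s₁ (κ,s) = ((Lc⁴)⁻¹)^{m+1} · Σ_ν Σ'_w Λ′_N μ y ν w · straightCount (Lc^{m+1}) ν w (κ,s)`
(PART 18 `lamR_succ` read backwards, then `lamR_eq_straightCount`). -/
theorem tsum_lamR_mul_symLinKerAt_eq_straightCount (m : ℕ) (μ κ : Fin (3 + 1)) (y s : Site (3 + 1)) :
    (∑ κ₁ : Fin (3 + 1), ∑' s₁ : Site (3 + 1),
        (∑ ν : Fin (3 + 1), ∑' w : Site (3 + 1),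
            (∑ κ' : Fin (3 + 1), ∑' u : Site (3 + 1),
                AN R j u (((Lc ^ (j + 1) : ℕ) : ℤ) • y) (Sum.inl κ') (Sum.inr μ) * lamCoeffOf (KInv (N := Lc ^ (j + 1)) (d := 3)) (Lc ^ (j + 1)) ν w κ' u)
              * compLinKer (fun _ => symLinKerAt (toSite R.r) Lc) Lc m (κ₁, s₁) (ν, w))
          * symLinKerAt (toSite R.r) Lc κ₁ s₁ (κ, s))
      = (((Lc : ℝ) ^ (3 + 1))⁻¹) ^ (m + 1) * ∑ ν : Fin (3 + 1), ∑' w : Site (3 + 1),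
          (∑ κ' : Fin (3 + 1), ∑' u : Site (3 + 1),
              AN R j u (((Lc ^ (j + 1) : ℕ) : ℤ) • y) (Sum.inl κ') (Sum.inr μ) * lamCoeffOf (KInv (N := Lc ^ (j + 1)) (d := 3)) (Lc ^ (j + 1)) ν w κ' u)
            * (straightCount (Lc ^ (m + 1)) ν w (κ, s) : ℝ) := by
  rw [← lamR_succ R j m μ κ y s, lamR_eq_straightCount R j (m + 1) μ κ y s]

/-- [folklore] **`lamR_full_eq_straightCount_pow`** — at full depth `m = j+1` (all `j+1` bricks of the N-vertex's blocking `L = Lc^(j+1)`): the response transported to the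
FINEST bonds is `((Lc⁴)⁻¹)^{j+1} · ⟪Λ′_N μ y, straightCount L · · (κ,s)⟫` — the straight `L`-contour pullback of `Λ′_N`, i.e. `𝒬_Lᵀ Λ′_N` up to the displayed power. -/
theorem lamR_full_eq_straightCount_pow (μ κ : Fin (3 + 1)) (y s : Site (3 + 1)) :
    (∑ ν : Fin (3 + 1), ∑' w : Site (3 + 1),
        (∑ κ' : Fin (3 + 1), ∑' u : Site (3 + 1),
            AN R j u (((Lc ^ (j + 1) : ℕ) : ℤ) • y) (Sum.inl κ') (Sum.inr μ) * lamCoeffOf (KInv (N := Lc ^ (j + 1)) (d := 3)) (Lc ^ (j + 1)) ν w κ' u)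
          * compLinKer (fun _ => symLinKerAt (toSite R.r) Lc) Lc (j + 1) (κ, s) (ν, w))
      = (((Lc : ℝ) ^ (3 + 1))⁻¹) ^ (j + 1) * ∑ ν : Fin (3 + 1), ∑' w : Site (3 + 1),
          (∑ κ' : Fin (3 + 1), ∑' u : Site (3 + 1),
              AN R j u (((Lc ^ (j + 1) : ℕ) : ℤ) • y) (Sum.inl κ') (Sum.inr μ) * lamCoeffOf (KInv (N := Lc ^ (j + 1)) (d := 3)) (Lc ^ (j + 1)) ν w κ' u)
            * (straightCount (Lc ^ (j + 1)) ν w (κ, s) : ℝ) :=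
  lamR_eq_straightCount R j (j + 1) μ κ y s

end Closed

end Summit.QuantumFields.BalabanUV.Beta.NVertexLamStraightPullback

end
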